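import Mathlib
import Summits.ValiantsHypothesis.ValiantsHypothesis.Theorems.DivisionGapPerDivisionHardStubJssContraction

/-!
# `DivisionGap.PerMultiplesHard` (stmt-ValiantsHypothesis-5068), line `uncharged-face-walk`:
stub `stub_jssContraction` — monomial factors are cheap to strip

**Jukna–Seiwert–Sergeev contraction** (JuknaSeiwertSergeev2022, Lemma 2; Jukna, *Tropical Circuit
Complexity* 2023, Lemma 6.16 with Claims 6.17–6.18 and Remark 6.19 for the semiring `ℝ≥0`), in
the tree's weighted fan-in-two monotone model `complexity` over `ℝ≥0`, RAW polynomial form: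

  `∃ κ, ∀ n f u, L⁺(f) ≤ ((n + 2) · (L⁺(x^u · f) + 2))^κ`   (`κ = 4`).

If `x^u · f` has a fan-in-two circuit of size `s` over `ℝ≥0` in the `n²` variables `x_ij`, then `f`
has one of size `≤ ((n + 2)(s + 2))^4`: carry the contraction `[g] = g / x^{gcd g}` gate by gate
(sum gates re-multiply the two contracted operands by `2^s`-bounded correction monomials produced
by repeated squaring, product gates just multiply — no cancellation and no zero divisors in `ℝ≥0`
make `gcd` additive and `[·]` multiplicative), and finish with `f = x^{gcd f} · [x^u f]`.

Log (stub-worker): the sibling crux `DivisionGap.PerDivisionHard` (stmt-ValiantsHypothesis-5065,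
line `pair-descent-jss-endpoint`) registered the IDENTICAL stub text and its full proof is
ACCEPTED in the tree (`Theorems/DivisionGapPerDivisionHardStubJssContraction.lean`, parts A/B with
the `contract`/`gcdVec` algebra and the block layout, p86475); one proof serves both cruxes, so
this file re-exports that theorem under this line's namespace with the registered header.
-/

noncomputable section

open MvPolynomial Literature.Computability.AlgebraicComplexity
open scoped NNReal BigOperators

namespace Summit.ValiantsHypothesis.ValiantsHypothesis.Theorems.DivisionGap.PerMultiplesHard.JSS

/-- **stub_jssContraction (Jukna–Seiwert–Sergeev, Lemma 2, in the weighted fan-in-two monotone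
model over `ℝ≥0`).**  A monomial cofactor helps at most polynomially: if `x^u · f` has a
fan-in-two circuit of size `s` over `ℝ≥0` in the `n²` variables `x_ij`, then `f` has one of size
`≤ ((n + 2)(s + 2))^κ` with `κ = 4` (gate-by-gate contraction `[g] = g / x^{gcd g}`, then
`f = x^{gcd f} · [x^u f]`).  This is the sibling crux's accepted theorem
`DivisionGapPerDivisionHard.stub_jssContraction`, re-exported verbatim.
[cite: JuknaSeiwertSergeev2022, Lemma 2] -/
theorem stub_jssContraction :
    ∃ κ : ℕ, ∀ (n : ℕ) (f : MvPolynomial (Fin n × Fin n) ℝ≥0) (u : (Fin n × Fin n) →₀ ℕ),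
      complexity f ≤ ((n + 2) * (complexity (monomial u (1 : ℝ≥0) * f) + 2)) ^ κ :=
  Summit.ValiantsHypothesis.ValiantsHypothesis.Theorems.DivisionGapPerDivisionHard.stub_jssContraction

end Summit.ValiantsHypothesis.ValiantsHypothesis.Theorems.DivisionGap.PerMultiplesHard.JSS

end
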